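import Summits.Ventures.HSemireg.WedgeHankelCoSiegelTower
import Summits.Ventures.HSemireg.WedgeHankelDivisorIntersection

/-!
# Venture HSemireg — TORELLI FOR NODES IN EVERY DEGREE: the kernel of a node class of order `P + 1 < k + 1` determines the node and the order; `k` frames never contain
# a `(k+1)`-th; node images dominated by a divisor of total order `k + 1` are independent — gen 14's D9 and gen 16's F2d without `r + 1 ≤ n + 1 − k`

HONEST FRAMING. Part of the Lean index of the computation cell `pub-hsemireg` (seat p10 gen 17, Sunday typer «UNIFORM-IN-n»).
Finite-dimensional EXTERIOR ALGEBRA over a field ONLY: no variety, no cohomology theory, no sheaf, no Ext group, no semiregularity map;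
nothing here says that HC / HC_CM / HC_AV holds; no Literature fact is declared or used.  Custodian versions as in `WedgeHankelSiegelIdeal` (1/3) and
`WedgeKernelDuality`; the dictionary (node classes `exp(λΘ)·p(Θ)` ↦ `w_n(expMul λ q)`; frames `{u^λ_a = x_a + λ y_a}`, `vol_λ = w_n(λ^•)`) is QUOTED, never asserted.

WHAT IS IN THE TREE.  D9 `WedgeHankelSecantTorelli` (gen 14): for `r + 1 ≤ k + 1` AND `r + 1 ≤ n + 1 − k` distinct slopes, `⋂_{i<r} F_{λ_i}(k) ⊄ F_μ(k)` and Torelli for secant node SETS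
(from D2's rank count); F2d `iSupIndep_V_w_expMul` (node images independent for `D ≤ k + 1` AND `D ≤ n + 1 − k`); G3/G4/G6 (this seat): `k + 1` frames / a divisor of total order
`k + 1` cut out `SI_k` in EVERY degree, `k` frames never do (`siegelIdeal_lt_iInf_Kr_w_exp`).  THIS FILE (namespace `Summit.Ventures.HSemireg.Wedge.KernelDuality` continued;
imports G6, G4):
* §101 the x-MONOMIALS `x_S` (`|S| = k ≤ n`): they kill every class supported on `[0, P]`, `P < k` (`xmon_mem_Kr_w_of_lt`), but **`xmon_mul_vol_ne_zero`: `x_S ∧ vol_ν ≠ 0` for `ν ≠ 0`**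
  (the top-x-count component is `ν^k x_S ∧ E_k`, and `x_S ∧ E_k ≠ 0` by gen 11's block law + `plane(k,0) ∩ SI_k = 0`) — in every degree `k ≤ n`.
* §102 **`Kr_w_expMul_not_le_Kr_w_exp`: for `μ ≠ λ` and `q` supported on `[0, P]`, `P < k ≤ n`: `Kr(univ, w_n(expMul μ q), k) ⊄ Kr(univ, w_n(A λ^•), k)`** — a form killing the
  node `μ` to order `P + 1 ≤ k` need not kill `exp(λΘ)` (witness `Φs μ (x_S)`); hence **NODE TORELLI `eq_of_Kr_w_expMul_eq`: equal degree-`k` kernels of two node classes of exact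
  orders `P, P′ < k` (`k + P, k + P′ ≤ n`) force the SAME NODE and the SAME ORDER** (`P = P′` by F2b's count); the pure case `eq_of_Kr_w_exp_eq'` (D9's `eq_of_Kr_w_expSeq_eq`
  had `k + 1 ≤ n`, here every `1 ≤ k ≤ n`).
* §103 **`iInf_Kr_w_exp_not_le_Kr_w_exp`: `k` distinct frames never contain a `(k+1)`-th — `⋂_{i<k} Kr(vol_{λ_i}, k) ⊄ Kr(vol_μ, k)` for `μ ∉ {λ_i}`, every `1 ≤ k ≤ n`** (else the
  `k + 1` frames would cut out `SI_k` by G3 while `k` frames give strictly more by G6); TORELLI FOR `k`-SETS OF FRAMES `range_eq_of_iInf_Kr_w_exp_eq` (two injective `k`-families with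
  the same kernel intersection have the same slope set).
* §104 **DOMINATED DIVISORS: `iSupIndep_V_w_expMul_of_le`** — the node images `V(univ, w_n(expMul λ_i q_i), k′)` of exact orders `P_i ≤ Q_i` are INDEPENDENT in degree `k′`
  whenever `Σ_i (Q_i + 1) = k + 1`, `Q_i ≤ k′` (`k + k′ = n`): G4's directness for the dominating divisor + `iSupIndep.mono` + monotonicity of node images in the order (E5 + E1); so F2d's directness
  holds with NO `D ≤ n + 1 − k` for every divisor sitting under a total-order-`(k+1)` divisor with the same nodes.
NOT typed here: Torelli for whole divisors (node set AND orders from the intersection; needs §104-type room), families of fewer than `k` slopes padded by fresh slopes;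
anything Ext-side.  Class side only; new names only.
-/

open Module

namespace Summit.Ventures.HSemireg.Wedge.KernelDuality

open Summit.Ventures.HSemireg.Wedge Summit.Ventures.HSemireg.Wedge.Kunneth Summit.Ventures.HSemireg.Wedge.Hankel
  Summit.Ventures.HSemireg.Wedge.HankelSiegel Summit.Ventures.HSemireg.Wedge.HankelSiegelIdeal Summit.Ventures.HSemireg.Wedge.KunnethKernel
  Summit.Ventures.HSemireg.Wedge.HankelSecant Summit.Ventures.HSemireg.Wedge.HankelFrameChange Summit.Ventures.HSemireg.Wedge.HankelPureKernel

variable (K : Type*) [Field K] {n : ℕ}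

/-! ## §101. The x-monomials: they kill low-order classes but never a frame volume of non-zero slope -/

/-- the x-monomial on a `k`-set `S`: `x_S := pmon (S, ∅) ∈ plane(k, 0)`. -/
lemma xmon_mem_plane {k : ℕ} (S : {S : Finset (Fin n) // S.card = k}) :
    pmon K ((S, ⟨∅, Finset.card_empty⟩) : PIdx n k 0) ∈ plane K n k 0 := Submodule.subset_span ⟨_, rfl⟩

/-- `x_S ≠ 0`. -/
lemma xmon_ne_zero {k : ℕ} (S : {S : Finset (Fin n) // S.card = k}) : pmon K ((S, ⟨∅, Finset.card_empty⟩) : PIdx n k 0) ≠ 0 :=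
  (linearIndependent_pmon K (n := n) k 0).ne_zero _

/-- a `k`-set of indices exists for `k ≤ n`. -/
lemma exists_kset {k : ℕ} (hk : k ≤ n) : ∃ S : Finset (Fin n), S.card = k := by
  obtain ⟨S, -, hS⟩ := Finset.exists_subset_card_eq (s := (Finset.univ : Finset (Fin n))) (n := k) (by rw [Finset.card_univ, Fintype.card_fin]; exact hk)
  exact ⟨S, hS⟩

/-- **`x_S` KILLS EVERY CLASS SUPPORTED ON `[0, P]` WITH `P < k`** (it has `k > P` x-letters; `k ≤ n`). -/
theorem xmon_mem_Kr_w_of_lt {k P : ℕ} (hPk : P < k) (hk : k ≤ n) {q : ℕ → K} (hq : ∀ j, P < j → q j = 0) (S : {S : Finset (Fin n) // S.card = k}) :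
    pmon K ((S, ⟨∅, Finset.card_empty⟩) : PIdx n k 0) ∈ Kr K Finset.univ (w K n n q) k := by
  have hx : pmon K ((S, ⟨∅, Finset.card_empty⟩) : PIdx n k 0) ∈ xRich K n k P := by
    have := plane_le_xRich K (n := n) (k := k) hPk le_rfl
    rw [Nat.sub_self] at this
    exact this (xmon_mem_plane K S)
  refine mem_Kr.mpr ⟨?_, mul_w_eq_zero_of_mem_xRich K hk hq hx⟩
  rw [Hom_univ_eq_exteriorPower]; exact xRich_le_exteriorPower K k P hx

/-- **`x_S ∧ E_k ≠ 0`** (`|S| = k ≤ n`): on `plane(k, 0)` the power `E_k` has window `(1, 0, …)`, so its kernel there is the isotropic part, which is `0` on a pure-x block. -/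
theorem xmon_mul_spike_ne_zero {k : ℕ} (S : {S : Finset (Fin n) // S.card = k}) :
    pmon K ((S, ⟨∅, Finset.card_empty⟩) : PIdx n k 0) * w K n n (fun j => if j = k then (1 : K) else 0) ≠ 0 := by
  intro h0
  have hker : (⟨_, xmon_mem_plane K S⟩ : plane K n k 0) ∈ LinearMap.ker (wedgeP K n k 0 (fun j => if j = k then (1 : K) else 0)) := by
    rw [LinearMap.mem_ker, wedgeP, LinearMap.comp_apply, Submodule.subtype_apply, LinearMap.mulRight_apply]; exact h0
  rw [ker_wedgeP_of_window_ne K (s := 0) (by omega) (by rw [Nat.add_zero, if_pos rfl]; exact one_ne_zero), Submodule.mem_comap, Submodule.subtype_apply,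
    Nat.add_zero] at hker
  have hmem : pmon K ((S, ⟨∅, Finset.card_empty⟩) : PIdx n k 0) ∈ plane K n k 0 ⊓ siegelIdeal K n k := ⟨xmon_mem_plane K S, hker⟩
  rw [plane_zero_inf_siegelIdeal'] at hmem
  exact xmon_ne_zero K S ((Submodule.mem_bot K).mp hmem)

/-- **`x_S ∧ vol_ν ≠ 0` for `ν ≠ 0`** (`|S| = k ≤ n`): the top-x-count component of `x_S ∧ vol_ν` is `ν^k · x_S ∧ E_k ≠ 0` (G3's `prj_mul_vol`). -/
theorem xmon_mul_vol_ne_zero {k : ℕ} (hk : k ≤ n) {nu : K} (hnu : nu ≠ 0) (S : {S : Finset (Fin n) // S.card = k}) :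
    pmon K ((S, ⟨∅, Finset.card_empty⟩) : PIdx n k 0) * w K n n (fun j => nu ^ j) ≠ 0 := by
  intro h0
  have hθ : pmon K ((S, ⟨∅, Finset.card_empty⟩) : PIdx n k 0) ∈ ⋀[K]^k (In n → K) := by
    have := plane_le_exteriorPower K (n := n) k 0 (xmon_mem_plane K S); rwa [Nat.add_zero] at this
  have h1 := congrArg (prj K n n k) h0
  rw [map_zero, prj_mul_vol K hk nu hθ, Finset.sum_eq_single k] at h1
  · rw [Nat.sub_self, prj_of_mem_plane K (xmon_mem_plane K S)] at h1
    rcases smul_eq_zero.mp h1 with h | h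
    · exact pow_ne_zero k hnu h
    · exact xmon_mul_spike_ne_zero K S h
  · intro a _ hak
    rw [prj_of_mem_plane_ne K (Or.inl hak) (xmon_mem_plane K S), zero_mul, smul_zero]
  · intro h; exact absurd (Finset.mem_range.mpr (Nat.lt_succ_self k)) h

/-- hence `x_S ∉ Kr(univ, w_n(A ν^•), k)` for `ν ≠ 0`, `A ≠ 0`. -/
lemma xmon_not_mem_Kr_w_exp {k : ℕ} (hk : k ≤ n) {nu A : K} (hnu : nu ≠ 0) (hA : A ≠ 0) (S : {S : Finset (Fin n) // S.card = k}) :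
    pmon K ((S, ⟨∅, Finset.card_empty⟩) : PIdx n k 0) ∉ Kr K Finset.univ (w K n n (fun j => A * nu ^ j)) k := fun h =>
  xmon_mul_vol_ne_zero K hk hnu S ((mul_w_exp_eq_zero_iff K hA nu _).mp (mem_Kr.mp h).2)

/-! ## §102. Node Torelli in every degree -/

/-- the frame change on pure classes: `expMul c (A ν^•) = A (ν + c)^•`. -/
lemma expMul_exp (c A nu : K) : expMul K c (fun j => A * nu ^ j) = fun j => A * (c + nu) ^ j := by
  have e : (fun j => A * nu ^ j) = expMul K nu (fun i => if i = 0 then A else 0) := funext fun j => (expMul_spike_zero K nu A j).symm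
  rw [e]; funext j; rw [expMul_expMul, expMul_spike_zero]

/-- **A FORM KILLING THE NODE `μ` TO ORDER `P + 1 ≤ k` NEED NOT KILL `exp(λΘ)`, `λ ≠ μ`: `Kr(univ, w_n(expMul μ q), k) ⊄ Kr(univ, w_n(A λ^•), k)`** for `q` supported on `[0, P]`,
`P < k ≤ n`, `A ≠ 0` — in EVERY such degree (witness: the frame-changed x-monomial `Φs μ (x_S)`). -/
theorem Kr_w_expMul_not_le_Kr_w_exp {lam mu : K} (hne : lam ≠ mu) {k P : ℕ} (hPk : P < k) (hk : k ≤ n) {q : ℕ → K} (hq : ∀ j, P < j → q j = 0) {A : K}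
    (hA : A ≠ 0) : ¬ Kr K Finset.univ (w K n n (expMul K mu q)) k ≤ Kr K Finset.univ (w K n n (fun j => A * lam ^ j)) k := by
  obtain ⟨S, hS⟩ := exists_kset (n := n) (by omega : k ≤ n)
  intro hle
  -- move the node μ to 0: Kr(w(expMul μ q)) = Φs μ Kr(w q), Kr(w(A λ^•)) = Φs μ Kr(w(A (λ−μ)^•))
  have e : (fun j => A * lam ^ j) = expMul K mu (fun j => A * (lam - mu) ^ j) := by rw [expMul_exp, add_sub_cancel]
  rw [e, Kr_w_expMul, Kr_w_expMul, Submodule.map_le_map_iff_of_injective (f := (Φs K (n := n) mu).toLinearMap) (Φs K (n := n) mu).injective] at hle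
  exact xmon_not_mem_Kr_w_exp K hk (sub_ne_zero.mpr hne) hA ⟨S, hS⟩ (hle (xmon_mem_Kr_w_of_lt K hPk hk hq ⟨S, hS⟩))

/-- the order-`(P+1)` node kernel lies in the frame ideal of its node: `Kr(univ, w_n(expMul λ q), k) ≤ Kr(univ, w_n(A λ^•), k)` (`q` of exact order `P`, `k + P ≤ n`; E5's names). -/
lemma Kr_w_expMul_le_Kr_w_exp (lam : K) {k P : ℕ} (hkP : k + P ≤ n) {q : ℕ → K} (hq : ∀ j, P < j → q j = 0) (hqP : q P ≠ 0) {A : K} (hA : A ≠ 0) :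
    Kr K Finset.univ (w K n n (expMul K lam q)) k ≤ Kr K Finset.univ (w K n n (fun j => A * lam ^ j)) k := by
  rw [Kr_w_expMul_of_order K lam hkP hq hqP, Kr_w_exp K lam (by omega) hA]
  exact sup_le_sup_left (Submodule.map_mono (xRich_anti K (Nat.zero_le P))) _

/-- **NODE TORELLI IN EVERY DEGREE**: node classes at `λ` and `μ` of exact orders `P, P′ < k` (`k + P ≤ n`, `k + P′ ≤ n`) with the SAME degree-`k` kernel have `λ = μ` and `P = P′`
— the kernel `SI_k ⊔ Φs λ (xRich(k, P))` of E5's law determines the node and the order as long as it is not the generic `SI_k` (`P < k`). -/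
theorem eq_of_Kr_w_expMul_eq {lam mu : K} {k P P' : ℕ} (hPk : P < k) (hP'k : P' < k) (hkP : k + P ≤ n) (hkP' : k + P' ≤ n) {q q' : ℕ → K}
    (hq : ∀ j, P < j → q j = 0) (hqP : q P ≠ 0) (hq' : ∀ j, P' < j → q' j = 0) (hqP' : q' P' ≠ 0)
    (heq : Kr K Finset.univ (w K n n (expMul K lam q)) k = Kr K Finset.univ (w K n n (expMul K mu q')) k) : lam = mu ∧ P = P' := by
  constructor
  · by_contra hne
    exact Kr_w_expMul_not_le_Kr_w_exp K (Ne.symm hne) hPk (by omega) hq one_ne_zero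
      (heq.le.trans (Kr_w_expMul_le_Kr_w_exp K mu hkP' hq' hqP' one_ne_zero))
  · have h1 := finrank_Kr_w_of_order K hkP hq hqP
    have h2 := finrank_Kr_w_of_order K hkP' hq' hqP'
    rw [min_eq_left (by omega : P ≤ k), ← finrank_Kr_w_expMul K lam q k, heq, finrank_Kr_w_expMul] at h1
    rw [min_eq_left (by omega : P' ≤ k)] at h2
    have hpos : 0 < n.choose k := Nat.choose_pos (by omega)
    have : (P + 1) * n.choose k = (P' + 1) * n.choose k := by omega
    have := Nat.eq_of_mul_eq_mul_right hpos this
    omega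

/-- the pure case: **`Kr(univ, w_n(A λ^•), k) = Kr(univ, w_n(B μ^•), k) ⇒ λ = μ`** for every `1 ≤ k ≤ n`, `B ≠ 0` (D9's `eq_of_Kr_w_expSeq_eq` had `k + 1 ≤ n`; for `A = 0` the
hypothesis cannot hold). -/
theorem eq_of_Kr_w_exp_eq' {k : ℕ} (hk1 : 1 ≤ k) (hk : k ≤ n) {A B lam mu : K} (hB : B ≠ 0)
    (heq : Kr K Finset.univ (w K n n (fun j => A * lam ^ j)) k = Kr K Finset.univ (w K n n (fun j => B * mu ^ j)) k) : lam = mu := by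
  by_contra hne
  have e : (fun j => A * lam ^ j) = expMul K lam (fun i => if i = 0 then A else 0) := funext fun j => (expMul_spike_zero K lam A j).symm
  rw [e] at heq
  exact Kr_w_expMul_not_le_Kr_w_exp K (Ne.symm hne) (P := 0) hk1 hk (fun j hj => if_neg (by omega)) hB heq.le

/-! ## §103. `k` frames never contain a `(k+1)`-th; Torelli for `k`-sets of frames -/

/-- **`k` DISTINCT FRAMES NEVER CONTAIN A `(k+1)`-th: `⋂_{i<k} Kr(univ, w_n(A_i λ_i^•), k) ⊄ Kr(univ, w_n(B μ^•), k)`** for `μ ∉ {λ_i}`, `1 ≤ k ≤ n` — some degree-`k` form kills the `k`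
exponentials `exp(λ_i Θ)` but not `exp(μΘ)` (else `k + 1` frames, which cut out `SI_k` by G3, would give the same as `k` frames, which do not by G6). -/
theorem iInf_Kr_w_exp_not_le_Kr_w_exp {k : ℕ} (hk1 : 1 ≤ k) (hk : k ≤ n) {lam : Fin k → K} (hlam : Function.Injective lam) {mu : K} (hmu : mu ∉ Set.range lam)
    {A : Fin k → K} (hA : ∀ i, A i ≠ 0) {B : K} (hB : B ≠ 0) :
    ¬ (⨅ i, Kr K Finset.univ (w K n n (fun j => A i * lam i ^ j)) k) ≤ Kr K Finset.univ (w K n n (fun j => B * mu ^ j)) k := by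
  intro hle
  have hcons : Function.Injective (Fin.cons mu lam : Fin (k + 1) → K) := Fin.cons_injective_of_injective hmu hlam
  have hAB : ∀ i : Fin (k + 1), (Fin.cons B A : Fin (k + 1) → K) i ≠ 0 := fun i => Fin.cases (by rw [Fin.cons_zero]; exact hB) (fun j => by rw [Fin.cons_succ]; exact hA j) i
  have hSI := iInf_Kr_w_exp_eq_siegelIdeal K hk (lam := Fin.cons mu lam) hcons (A := Fin.cons B A) hAB
  have e : (⨅ i : Fin (k + 1), Kr K Finset.univ (w K n n (fun j => (Fin.cons B A : Fin (k + 1) → K) i * (Fin.cons mu lam : Fin (k + 1) → K) i ^ j)) k) =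
      Kr K Finset.univ (w K n n (fun j => B * mu ^ j)) k ⊓ ⨅ i, Kr K Finset.univ (w K n n (fun j => A i * lam i ^ j)) k := by
    refine le_antisymm (le_inf ?_ (le_iInf fun i => ?_)) (le_iInf fun i => ?_)
    · exact (iInf_le _ 0).trans (by simp only [Fin.cons_zero]; exact le_rfl)
    · exact (iInf_le _ i.succ).trans (by simp only [Fin.cons_succ]; exact le_rfl)
    · refine Fin.cases ?_ (fun j => ?_) i
      · simp only [Fin.cons_zero]; exact inf_le_left
      · simp only [Fin.cons_succ]; exact inf_le_right.trans (iInf_le _ j)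
  rw [e, inf_eq_right.mpr hle] at hSI
  exact (siegelIdeal_lt_iInf_Kr_w_exp K hk hk1 le_rfl lam hA).ne hSI.symm

/-- **TORELLI FOR `k`-SETS OF FRAMES**: two injective `k`-families of slopes (`1 ≤ k ≤ n`, non-zero weights) with the same kernel intersection in degree `k` have the same slope SET. -/
theorem range_eq_of_iInf_Kr_w_exp_eq {k : ℕ} (hk1 : 1 ≤ k) (hk : k ≤ n) {lam nu : Fin k → K} (hlam : Function.Injective lam) (hnu : Function.Injective nu)
    {A B : Fin k → K} (hA : ∀ i, A i ≠ 0) (hB : ∀ i, B i ≠ 0)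
    (heq : (⨅ i, Kr K Finset.univ (w K n n (fun j => A i * lam i ^ j)) k) = ⨅ i, Kr K Finset.univ (w K n n (fun j => B i * nu i ^ j)) k) :
    Set.range lam = Set.range nu := by
  have key : ∀ {lam nu : Fin k → K} {A B : Fin k → K}, Function.Injective lam → (∀ i, A i ≠ 0) → (∀ i, B i ≠ 0) →
      (⨅ i, Kr K Finset.univ (w K n n (fun j => A i * lam i ^ j)) k) ≤ (⨅ i, Kr K Finset.univ (w K n n (fun j => B i * nu i ^ j)) k) →
        Set.range nu ⊆ Set.range lam := by
    intro lam nu A B hlam hA hB hle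
    rintro _ ⟨i, rfl⟩
    by_contra hmem
    exact iInf_Kr_w_exp_not_le_Kr_w_exp K hk1 hk hlam hmem hA (hB i) (hle.trans (iInf_le _ i))
  exact Set.Subset.antisymm (key hnu hB hA heq.ge) (key hlam hA hB heq.le)

/-! ## §104. Dominated divisors: node images are independent -/

/-- **NODE IMAGES GROW WITH THE ORDER, at any node, in every degree where E5 names the kernels**: exact orders `P ≤ Q` with `k + Q ≤ n`, `k + k′ = n` ⇒
`V(univ, w_n(expMul λ q), k′) ≤ V(univ, w_n(expMul λ r), k′)` (the kernels shrink: `SI_k ⊔ Φs λ xRich(k,Q) ≤ SI_k ⊔ Φs λ xRich(k,P)`, and `V = Ann(Kr)` reverses inclusions). -/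
lemma V_w_expMul_mono_of_order (lam : K) {k k' P Q : ℕ} (hkk' : k + k' = n) (hPQ : P ≤ Q) (hkQ : k + Q ≤ n) {q r : ℕ → K}
    (hq : ∀ j, P < j → q j = 0) (hqP : q P ≠ 0) (hr : ∀ j, Q < j → r j = 0) (hrQ : r Q ≠ 0) :
    V K (In n) Finset.univ (w K n n (expMul K lam q)) k' ≤ V K (In n) Finset.univ (w K n n (expMul K lam r)) k' := by
  rw [V_w_eq_Ann K hkk', V_w_eq_Ann K hkk']
  refine Ann_anti K _ ?_
  rw [Kr_w_expMul_of_order K lam hkQ hr hrQ, Kr_w_expMul_of_order K lam (by omega) hq hqP]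
  exact sup_le_sup_left (Submodule.map_mono (xRich_anti K hPQ)) _

/-- **NODE IMAGES OF A DOMINATED DIVISOR ARE INDEPENDENT**: distinct `λ_i`, exact orders `P_i ≤ Q_i ≤ k′` with `Σ_i (Q_i + 1) = k + 1` (`k + k′ = n`) ⇒
`iSupIndep (i ↦ V(univ, w_n(expMul λ_i q_i), k′))` — G4's directness for the dominating divisor of total order `k + 1` and `iSupIndep.mono`. No `D ≤ n + 1 − k` (F2d). -/
theorem iSupIndep_V_w_expMul_of_le {k k' r : ℕ} (hkk' : k + k' = n) {lam : Fin r → K} (hlam : Function.Injective lam) {P Q : Fin r → ℕ} (hPQ : ∀ i, P i ≤ Q i)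
    (hQk' : ∀ i, Q i ≤ k') (hD : ∑ i, (Q i + 1) = k + 1) {q : Fin r → ℕ → K} (hq : ∀ i j, P i < j → q i j = 0) (hqP : ∀ i, q i (P i) ≠ 0) :
    iSupIndep (fun i => V K (In n) Finset.univ (w K n n (expMul K (lam i) (q i))) k') := by
  -- the dominating divisor, realised by the spikes δ_{Q_i}
  have hbig := iSupIndep_V_w_expMul'' K hkk' hlam (P := Q) (q := fun i j => if j = Q i then (1 : K) else 0)
    (fun i j hj => if_neg (by omega)) (fun i => by simp) hQk' hD
  refine hbig.mono fun i => ?_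
  exact V_w_expMul_mono_of_order K (lam i) hkk' (hPQ i) (by have := hQk' i; omega) (hq i) (hqP i) (fun j hj => if_neg (by omega)) (by simp)

end Summit.Ventures.HSemireg.Wedge.KernelDuality
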